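import Summits.QuantumAdvantage.AdviceFreeQNC0.RegisterChainBlocks
import Summits.QuantumAdvantage.AdviceFreeQNC0.BondPathSum
import Summits.QuantumAdvantage.AdviceFreeQNC0.NPGamma37Slicing
import HarnessLib

/-!
# Cell qa-qnc0, `p = 3` — the register chain DRIVEN BY THE RING WALK: trajectory, decoding, boundary data
(prover qn-prover-3 g22; bookkeeping for `twistBoundX3Local_of`, planner qa-qnc0-p1 g20 `exp20/Sketch20x.lean` §7)

The register chain of `BondTwistLocal.lean` reads the LETTERS `x_0, x_1, …` of an odd-class pattern `x = xOfU u` (walk bits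
`u ∈ {0,1}ⁿ`, `N = n + 1` letters): the spin is the current walk bit, the position is MINUS the walk state `st u i` (the chain moves by
`spinZ`, the walk by `stepZ = −spinZ`), the register holds the last `2r` letters.

* `xs u` — the letter stream; `stU u i` — the state before letter `i`; **`traj_xs`** — the chain driven by `xs u` from `initState` passes
  through the states `stU u i` (`i ≤ n`);
* decoding (`regLetter`, `backSpin`, `backPos`): from the state before letter `i` one reads off the letters `x_{i−1−m}`, the walk
  bits `u_{i−1−m}` and the walk states `st u (i−m)` for `m ≤ 2r` (**`backPos_stU`**);
* forward data of a letter prefix `a` (`uFwd`, `stFwd`; **`stFwd_eq`**): the walk states `st u k`, `k ≤ 2r`, of every `u` whose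
  first `2r` letters are `a`;
* `letters_injective` — the walk bits are determined by the letters; `pathW_congr`;
* **`winSign_eq_sum`** — the sign `(−1)^{WIN}` of an arbitrary walk strategy as `Σ_τ [st u n = τ]·Π_k (−1)^{[bell k fires ∧ κ+st u k+τ ≠ 0]}`.

WHAT THIS IS NOT: no bound here (`TwistBoundX3LocalProof.lean`); crux 22907 untouched; separation NOT moved.
-/

noncomputable section

namespace Summit.QuantumAdvantage.AdviceFreeQNC0

open Finset Literature.Computability.MetaComplexity Literature.Computability.QuantumComplexity

namespace BondTwist3

open TransferWalk ConstBells TwistedTransfer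

variable {n r : ℕ}

/-! ## The letter stream and the claimed trajectory -/

/-- The letter stream of the walk bits `u`: `x_j = xOfU u j` for `j ≤ n`, `false` beyond. -/
def xs (u : Fin n → Bool) (j : ℕ) : Bool := if h : j < n + 1 then xOfU u ⟨j, h⟩ else false

/-- The previous walk bit `u_{i−1}` (`u_{−1} = 0`). -/
def sPrev (u : Fin n → Bool) (i : ℕ) : Bool := if i = 0 then false else uExt u (i - 1)

/-- The register before letter `i`: the letters `x_{i−2r}, …, x_{i−1}` (oldest first; `false` at negative indices). -/
def regU (r : ℕ) (u : Fin n → Bool) (i : ℕ) : Fin (2 * r) → Bool :=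
  fun m => if 2 * r ≤ i + m.val then xs u (i + m.val - 2 * r) else false

/-- The claimed state before letter `i`: position `−st u i`, spin `u_{i−1}`, register of the last `2r` letters. -/
def stU (r : ℕ) (u : Fin n → Bool) (i : ℕ) : RegState r := (-(st u i), sPrev u i, regU r u i)

/-- The initial state: position `0`, spin `0`, empty (all-`false`) register. -/
def initState (r : ℕ) : RegState r := (0, false, fun _ => false)

/-- The letter `x_j` in terms of the walk bits: `x_j = ¬(u_j ⊕ u_{j−1})`. -/
theorem xs_eq (u : Fin n → Bool) {j : ℕ} (hj : j < n + 1) : xs u j = !(xor (uExt u j) (sPrev u j)) := by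
  unfold xs sPrev xOfU
  rw [dif_pos hj]

/-- `W_{<j+1} = W_{<j} + [u_j]`. -/
theorem wtPrefix_succ' (u : Fin n → Bool) {j : ℕ} (hj : j < n) :
    wtPrefix u (j + 1) = wtPrefix u j + (if u ⟨j, hj⟩ then 1 else 0) := by
  unfold wtPrefix
  have hsplit : (univ.filter fun i : Fin n => i.val < j + 1 ∧ u i = true)
      = (univ.filter fun i : Fin n => i.val < j ∧ u i = true) ∪
        (univ.filter fun i : Fin n => i = ⟨j, hj⟩ ∧ u i = true) := by
    ext i
    simp only [mem_filter, mem_univ, true_and, mem_union]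
    constructor
    · rintro ⟨hi, hu⟩
      rcases Nat.lt_succ_iff_lt_or_eq.mp hi with h | h
      · exact Or.inl ⟨h, hu⟩
      · exact Or.inr ⟨Fin.ext h, hu⟩
    · rintro (⟨hi, hu⟩ | ⟨rfl, hu⟩)
      · exact ⟨by omega, hu⟩
      · exact ⟨by simp, hu⟩
  rw [hsplit, card_union_of_disjoint (disjoint_left.2 fun i h1 h2 => by
    rw [mem_filter] at h1 h2; rw [h2.2.1] at h1; simp at h1)]
  congr 1
  by_cases hu : u ⟨j, hj⟩ = true
  · rw [if_pos hu]
    have : (univ.filter fun i : Fin n => i = ⟨j, hj⟩ ∧ u i = true) = {⟨j, hj⟩} := by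
      ext i; simp only [mem_filter, mem_univ, true_and, mem_singleton]
      constructor
      · rintro ⟨rfl, _⟩; rfl
      · rintro rfl; exact ⟨rfl, hu⟩
    rw [this, card_singleton]
  · rw [if_neg hu]
    have : (univ.filter fun i : Fin n => i = ⟨j, hj⟩ ∧ u i = true) = ∅ :=
      filter_eq_empty_iff.2 fun i _ h => hu (h.1 ▸ h.2)
    rw [this, card_empty]

/-- The walk state recursion: `st u (j+1) = st u j + 1 + [u_j]`. -/
theorem st_succ (u : Fin n → Bool) {j : ℕ} (hj : j < n) :
    st u (j + 1) = st u j + 1 + (if u ⟨j, hj⟩ then 1 else 0) := by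
  unfold st
  rw [wtPrefix_succ' u hj]
  split_ifs <;> push_cast <;> ring

/-- `st u 0 = 0`. -/
theorem st_zero (u : Fin n → Bool) : st u 0 = 0 := by
  unfold st; rw [TransferWalk.wtPrefix_zero]; simp

/-- **One step of the chain driven by the letters**: `nextState (stU u i) x_i = stU u (i+1)` for `i < n`. -/
theorem nextState_stU (u : Fin n → Bool) {i : ℕ} (hi : i < n) :
    nextState (stU r u i) (xs u i) = stU r u (i + 1) := by
  have hx := xs_eq u (show i < n + 1 by omega)
  -- the new spin is `u_i`
  have hspin : (if xs u i then sPrev u i else !sPrev u i) = uExt u i := by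
    rw [hx]; cases uExt u i <;> cases sPrev u i <;> rfl
  have hprev : sPrev u (i + 1) = uExt u i := by unfold sPrev; simp
  unfold stU nextState
  simp only
  rw [hspin, hprev]
  refine Prod.ext ?_ (Prod.ext rfl ?_)
  · -- position
    show -st u i + spinZ (uExt u i) = -st u (i + 1)
    rw [st_succ u hi, NPGamma37Proof.uExt_of_lt u hi]
    unfold spinZ
    have h3 : (3 : ZMod 3) = 0 := by decide
    cases u ⟨i, hi⟩
    · simp only [Bool.false_eq_true, if_false]; ring
    · simp only [if_true]; linear_combination h3
  · -- register
    funext m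
    show shiftIn (regU r u i) (xs u i) m = regU r u (i + 1) m
    unfold shiftIn regU
    by_cases hm : m.val + 1 < 2 * r
    · rw [dif_pos hm]
      simp only
      by_cases h2 : 2 * r ≤ i + (m.val + 1)
      · rw [if_pos h2, if_pos (by omega), show i + (m.val + 1) - 2 * r = i + 1 + m.val - 2 * r by omega]
      · rw [if_neg h2, if_neg (by omega)]
    · rw [dif_neg hm]
      have hm' : m.val + 1 = 2 * r := by omega
      rw [if_pos (by omega), show i + 1 + m.val - 2 * r = i by omega]

/-- **The chain driven by the letters passes through the claimed states**: `traj (xs u) initState i = stU u i` for `i ≤ n`. -/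
theorem traj_xs (u : Fin n → Bool) : ∀ i : ℕ, i ≤ n → traj (xs u) (initState r) i = stU r u i
  | 0, _ => by
    rw [traj_zero]
    unfold initState stU sPrev regU
    rw [st_zero, neg_zero]
    simp only [if_true]
    refine Prod.ext rfl (Prod.ext rfl ?_)
    funext m
    have hm := m.isLt
    simp only
    rw [if_neg (by omega)]
  | i + 1, hi => by
    rw [traj_succ, traj_xs u i (by omega), nextState_stU u (by omega)]

/-! ## Decoding the register -/

/-- The letter `m+1` steps back: `x_{i−1−m}` (read from the register, newest last). -/
def regLetter (σ : RegState r) (m : ℕ) : Bool :=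
  if h : m < 2 * r then σ.2.2 ⟨2 * r - 1 - m, by omega⟩ else false

/-- The walk bit `m+1` steps back: `u_{i−1−m}` (`u_{j−1} = u_j ⊕ ¬x_j`). -/
def backSpin (σ : RegState r) : ℕ → Bool
  | 0 => σ.2.1
  | m + 1 => xor (backSpin σ m) (!regLetter σ m)

/-- The walk state `m` steps back: `st u (i−m)` (`st u (j−1) = st u j − 1 − [u_{j−1}]`). -/
def backPos (σ : RegState r) : ℕ → ZMod 3
  | 0 => -σ.1
  | m + 1 => backPos σ m - 1 - (if backSpin σ m then 1 else 0)

/-- The register of `stU u i` holds the letters. -/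
theorem regLetter_stU (u : Fin n → Bool) {i m : ℕ} (hm : m < 2 * r) (hmi : m + 1 ≤ i) :
    regLetter (stU r u i) m = xs u (i - 1 - m) := by
  unfold regLetter stU regU
  rw [dif_pos hm]
  simp only
  rw [if_pos (by omega), show i + (2 * r - 1 - m) - 2 * r = i - 1 - m by omega]

/-- Decoding the walk bits: `backSpin (stU u i) m = u_{i−1−m}`. -/
theorem backSpin_stU (u : Fin n → Bool) {i : ℕ} (hi : i ≤ n) :
    ∀ m : ℕ, m + 1 ≤ i → m ≤ 2 * r → backSpin (stU r u i) m = uExt u (i - 1 - m)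
  | 0, h0, _ => by
    show sPrev u i = uExt u (i - 1 - 0)
    unfold sPrev; rw [if_neg (by omega), Nat.sub_zero]
  | m + 1, hm, hmr => by
    show xor (backSpin (stU r u i) m) (!regLetter (stU r u i) m) = uExt u (i - 1 - (m + 1))
    rw [backSpin_stU u hi m (by omega) (by omega), regLetter_stU u (by omega) (by omega),
      xs_eq u (show i - 1 - m < n + 1 by omega)]
    have hp : sPrev u (i - 1 - m) = uExt u (i - 1 - (m + 1)) := by
      unfold sPrev; rw [if_neg (by omega), show i - 1 - m - 1 = i - 1 - (m + 1) by omega]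
    rw [hp]
    cases uExt u (i - 1 - m) <;> cases uExt u (i - 1 - (m + 1)) <;> rfl

/-- **Decoding the walk states**: `backPos (stU u i) m = st u (i − m)` for `m ≤ i ≤ n`, `m ≤ 2r + 1`. -/
theorem backPos_stU (u : Fin n → Bool) {i : ℕ} (hi : i ≤ n) :
    ∀ m : ℕ, m ≤ i → m ≤ 2 * r + 1 → backPos (stU r u i) m = st u (i - m)
  | 0, _, _ => by show -(-(st u i)) = st u (i - 0); rw [neg_neg, Nat.sub_zero]
  | m + 1, hm, hmr => by
    show backPos (stU r u i) m - 1 - (if backSpin (stU r u i) m then 1 else 0) = st u (i - (m + 1))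
    rw [backPos_stU u hi m (by omega) (by omega), backSpin_stU u hi m (by omega) (by omega),
      NPGamma37Proof.uExt_of_lt u (show i - 1 - m < n by omega)]
    have h := st_succ u (show i - 1 - m < n by omega)
    rw [show i - 1 - m + 1 = i - m by omega] at h
    rw [h, show i - (m + 1) = i - 1 - m by omega]
    ring

/-! ## Forward data of a letter prefix -/

/-- Letters of a prefix `a ∈ {0,1}^{2r}`, `false` beyond. -/
def aExt (a : Fin (2 * r) → Bool) (j : ℕ) : Bool := if h : j < 2 * r then a ⟨j, h⟩ else false

/-- The walk bits of a prefix: `uFwd a (j+1) = u_j` (`u_{−1} = 0`, `u_j = u_{j−1} ⊕ ¬x_j`). -/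
def uFwd (a : Fin (2 * r) → Bool) : ℕ → Bool
  | 0 => false
  | j + 1 => xor (uFwd a j) (!aExt a j)

/-- The walk states of a prefix: `stFwd a k = st u k` for `k ≤ 2r`. -/
def stFwd (a : Fin (2 * r) → Bool) : ℕ → ZMod 3
  | 0 => 0
  | k + 1 => stFwd a k + 1 + (if uFwd a (k + 1) then 1 else 0)

/-- `u` has letter prefix `a`. -/
def HasPrefix (a : Fin (2 * r) → Bool) (u : Fin n → Bool) : Prop := ∀ j : ℕ, j < 2 * r → xs u j = aExt a j

/-- The walk bits of a pattern with prefix `a` (`2r ≤ n`). -/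
theorem uFwd_eq {a : Fin (2 * r) → Bool} {u : Fin n → Bool} (hrn : 2 * r ≤ n) (ha : HasPrefix a u) :
    ∀ j : ℕ, j ≤ 2 * r → uFwd a j = sPrev u j
  | 0, _ => by unfold uFwd sPrev; simp
  | j + 1, hj => by
    show xor (uFwd a j) (!aExt a j) = sPrev u (j + 1)
    rw [uFwd_eq hrn ha j (by omega), ← ha j (by omega), xs_eq u (show j < n + 1 by omega)]
    have hp : sPrev u (j + 1) = uExt u j := by unfold sPrev; simp
    rw [hp]
    cases uExt u j <;> cases sPrev u j <;> rfl

/-- **The walk states of a pattern with prefix `a`**: `stFwd a k = st u k` for `k ≤ 2r ≤ n`. -/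
theorem stFwd_eq {a : Fin (2 * r) → Bool} {u : Fin n → Bool} (hrn : 2 * r ≤ n) (ha : HasPrefix a u) :
    ∀ k : ℕ, k ≤ 2 * r → stFwd a k = st u k
  | 0, _ => by unfold stFwd; rw [st_zero]
  | k + 1, hk => by
    show stFwd a k + 1 + (if uFwd a (k + 1) then 1 else 0) = st u (k + 1)
    rw [stFwd_eq hrn ha k (by omega), uFwd_eq hrn ha (k + 1) hk, st_succ u (show k < n by omega)]
    have hp : sPrev u (k + 1) = u ⟨k, by omega⟩ := by
      unfold sPrev; rw [if_neg (by omega), Nat.add_sub_cancel, NPGamma37Proof.uExt_of_lt u (by omega)]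
    rw [hp]

/-! ## Letters determine the walk bits -/

/-- The first `n` letters, as a string. -/
def letters (u : Fin n → Bool) : Fin n → Bool := fun m => xs u m.val

/-- `extB (letters u)` agrees with the letter stream on `[0, n)`. -/
theorem extB_letters (u : Fin n → Bool) {m : ℕ} (hm : m < n) : extB (letters u) m = xs u m := by
  unfold extB letters; rw [dif_pos hm]

/-- **The letters determine the walk bits.** -/
theorem letters_injective : Function.Injective (letters (n := n)) := by
  intro u v h
  have hx : ∀ m : ℕ, m < n → xs u m = xs v m := fun m hm => by
    have := congrFun h ⟨m, hm⟩; exact this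
  -- by induction the walk bits agree
  have key : ∀ m : ℕ, m ≤ n → sPrev u m = sPrev v m := by
    intro m
    induction m with
    | zero => intro; rfl
    | succ m ih =>
      intro hm
      have e := hx m (by omega)
      rw [xs_eq u (by omega), xs_eq v (by omega), ← ih (by omega)] at e
      have hp : ∀ w : Fin n → Bool, sPrev w (m + 1) = uExt w m := fun w => by unfold sPrev; simp
      rw [hp, hp]
      revert e
      cases uExt u m <;> cases uExt v m <;> cases sPrev u m <;> decide
  funext ⟨m, hm⟩
  have e := key (m + 1) (by omega)
  unfold sPrev at e
  rw [if_neg (by omega), if_neg (by omega), Nat.add_sub_cancel, NPGamma37Proof.uExt_of_lt u hm, NPGamma37Proof.uExt_of_lt v hm] at e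
  exact e

/-- Trajectories depend only on the letters read. -/
theorem traj_congr {x x' : ℕ → Bool} (σ : RegState r) : ∀ L : ℕ, (∀ m, m < L → x m = x' m) → traj x σ L = traj x' σ L
  | 0, _ => rfl
  | L + 1, h => by rw [traj_succ, traj_succ, traj_congr σ L (fun m hm => h m (by omega)), h L (by omega)]

/-- Path weights depend only on the letters read. -/
theorem pathW_congr (W : ℕ → RegState r → Bool → ℂ) (f : RegState r → ℂ) (i : ℕ) (σ : RegState r) (L : ℕ)
    {x x' : ℕ → Bool} (h : ∀ m, m < L → x m = x' m) : pathW W f i σ L x = pathW W f i σ L x' := by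
  unfold pathW
  rw [traj_congr σ L h]
  congr 1
  exact prod_congr rfl fun m hm => by
    rw [mem_range] at hm
    rw [traj_congr σ m (fun m' hm' => h m' (by omega)), h m hm]

/-- **Re-indexing a sum over walk bits by the letters.** -/
theorem sum_letters (F : (Fin n → Bool) → ℂ) : ∑ u : Fin n → Bool, F (letters u) = ∑ b : Fin n → Bool, F b :=
  Equiv.sum_comp (Equiv.ofBijective _ (Finite.injective_iff_bijective.1 letters_injective)) F

/-! ## The sign of the outcome of an arbitrary walk strategy -/

/-- `(−1)^m` as `±1`. -/
theorem neg_one_pow_eq_ite (m : ℕ) : ((-1 : ℂ)) ^ m = if m % 2 = 1 then -1 else 1 := by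
  rcases Nat.even_or_odd m with h | h
  · rw [h.neg_one_pow, if_neg (by rw [Nat.even_iff] at h; omega)]
  · rw [h.neg_one_pow, if_pos (Nat.odd_iff.mp h)]

/-- The sign `(−1)^{WIN}` of a walk strategy `y` at charge `c` is the product of the bell signs. -/
theorem winSign_eq_prod (c : ℕ) (y : Fin (n + 1) → (Fin n → Bool) → Bool) (u : Fin n → Bool) :
    (if ringWinU c y u = true then (-1 : ℂ) else 1) =
      ∏ g : Fin (n + 1), (if (y g u = true ∧ (c + g.val + walkExp u g.val) % 3 ≠ 0) then (-1 : ℂ) else 1) := by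
  classical
  rw [Finset.prod_ite, prod_const_one, mul_one, prod_const, neg_one_pow_eq_ite]
  unfold ringWinU
  simp only [decide_eq_true_eq]

/-- **The sign as a sum over the final walk state** (`κ = c + 2n`): `(−1)^{WIN} = Σ_τ [st u n = τ]·Π_g (−1)^{[y_g ∧ κ + st u g + τ ≠ 0]}`. -/
theorem winSign_eq_sum (c : ℕ) (y : Fin (n + 1) → (Fin n → Bool) → Bool) (u : Fin n → Bool) :
    (if ringWinU c y u = true then (-1 : ℂ) else 1) =
      ∑ τ : ZMod 3, (if st u n = τ then (1 : ℂ) else 0) *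
        ∏ g : Fin (n + 1), (if (y g u = true ∧ ((c + 2 * n : ℕ) : ZMod 3) + st u g.val + τ ≠ 0) then (-1 : ℂ) else 1) := by
  rw [winSign_eq_prod]
  symm
  rw [Finset.sum_eq_single (st u n) (fun τ _ hτ => by rw [if_neg (Ne.symm hτ), zero_mul])
    (fun h => absurd (mem_univ _) h), if_pos rfl, one_mul]
  refine prod_congr rfl fun g _ => ?_
  have hiff := charge_iff c u g.val
  by_cases h1 : y g u = true ∧ ((c + 2 * n : ℕ) : ZMod 3) + st u g.val + st u n ≠ 0
  · rw [if_pos h1, if_pos ⟨h1.1, hiff.2 h1.2⟩]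
  · rw [if_neg h1, if_neg (fun h2 => h1 ⟨h2.1, hiff.1 h2.2⟩)]

end BondTwist3

end Summit.QuantumAdvantage.AdviceFreeQNC0

end
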